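import Summits.BirchSwinnertonDyer.BirchSwinnertonDyer.Theses.ErratumRoadFive
import Summits.BirchSwinnertonDyer.BirchSwinnertonDyer.Theorems.ErratumRoadFiveRest3TorsionBranchB
import HarnessLib

/-!
# Route `ErratumRoadFive` (K2 at `p ≥ 5`): the two NO-ROAD residual cruxes 19282 `OpenInputNotRam` and
# 19624 `RamNoErratumDataAtFive` (and the aside parent 19061 `OpenInputIMC`) BY NAME from the ORIENTED value-free
# atom (2.4)∃♭ᴮ `P2.IMCDivSomeFrameOnTreeB` + the route's published inputs (item 19283 or 19066) + the JIMJ18 display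

Cell `bsd-stepL` (run/shared/lean/pub/bsd-stepL/), seat `bsd-stepL-bdp` (prover g17, 2026-08-27; the B-twin of g12's
`Theorems/ErratumRoadFiveNoRoadResidualsValueFree.lean` (p446…), listed NOT done in g16's census A-3 and referee g42's
VERDICT-CENSUS-A3 (C5)). `--supports stmt-BirchSwinnertonDyer-19282 --as helper`. Route-level (by-name) corollaries
of bsd-stepL-bdp g16's Theses-free oriented T = 0 passage `Rest3TorsionBranchB.openInputOnTreeAt_of_imcDivSomeFrameB_of_pNew`
(p498588); this module imports the route file, so it is NOT citable from `closes` (the kernel twin is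
`KernelFromPrintB.openInputIMCBody_of_print_of_coreB_of_imcDivSomeFrameB`, Theses-free, same session).

* `openInputNotRam_of_publishedInputs_of_pNew_of_imcDivSomeFrameB` (+ `…_of_publishedInputsFive…`) — item 19282
  `OpenInputNotRam` ⟸ `PublishedInputsIMCReduction` (19283) [resp. `PublishedInputsFive` (19066)] + the reviewed fact
  `thm210_thm211_bdpDisplay_pNew` + (2.4)∃♭ᴮ on the ¬(ram) pairs (= the v3B skeleton's `_of_atomB`).
* `ramNoErratumDataAtFive_of_publishedInputs_of_pNew_of_imcDivSomeFrameB` (+ `…Five…`) — item 19624 ⟸ the same +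
  (2.4)∃♭ᴮ on its pairs.
* `openInputIMC_of_publishedInputs_of_pNew_of_imcDivSomeFrameBAll` — the aside parent 19061 ⟸ (2.4)∃♭ᴮ on ALL
  classical data.

HONEST FRAMING: implications only; (2.4)∃♭ᴮ is OPEN on these rows (no printed supplier; the erratum road at erratum
data, crux 20169, is the road of record on the (ram) atom; ROAD B12 p507771 is a LINE into the atom); nothing is
booked; no label, tier or census word moves (T7).
-/

set_option autoImplicit false
set_option linter.dupNamespace false

noncomputable section

open scoped Classical
open Literature.NumberTheory.EllipticCurves Literature.NumberTheory.EllipticCurves.Rank1Residual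
open Literature.NumberTheory.EllipticCurves.Castella2018Exceptional
open Summit.BirchSwinnertonDyer.Rank1Residual Summit.BirchSwinnertonDyer.Rank1Residual.X11b
open Summit.BirchSwinnertonDyer.BirchSwinnertonDyer.Theses
open Summit.BirchSwinnertonDyer.BirchSwinnertonDyer.Theorems.Rest3TorsionBranchB

namespace Summit.BirchSwinnertonDyer.BirchSwinnertonDyer.Theorems

/-- **Item 19282 `OpenInputNotRam` from item 19283 + the JIMJ18 fact + (2.4)∃♭ᴮ on the ¬(ram) pairs** (oriented twin of
g12's `openInputNotRam_of_publishedInputs_of_pNew_of_imcDivSomeFrame`). CONDITIONAL on (2.4)∃♭ᴮ there (OPEN).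
[cite: Castella2018Exceptional, Thms. 2.10–2.11 (arXiv:1507.04260 pp. 13–14)]
[cite: Castella2018Erratum, (2.4) (p. 4)] [cite: Castella2018, Thms. 2.3, 3.1, 3.2, §5] -/
theorem openInputNotRam_of_publishedInputs_of_pNew_of_imcDivSomeFrameB
    (hF : ErratumRoadFive.PublishedInputsIMCReduction) (hB : thm210_thm211_bdpDisplay_pNew)
    (hDiv : ∀ (W : WeierstrassCurve ℚ) [W.IsElliptic] [W.IsGloballyMinimal] (p : ℕ) [Fact p.Prime],
      ¬ Ram W p → P2.IMCDivSomeFrameOnTreeB W p) :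
    ErratumRoadFive.OpenInputNotRam := by
  obtain ⟨-, hGZK, -, hnf, -, -, -, -, hKo, -, -, hPT, -, -, hEP, -⟩ := hF
  intro W _ _ p _ hnr
  exact openInputOnTreeAt_of_imcDivSomeFrameB_of_pNew hnf hGZK hKo hPT hEP hB (hDiv W p hnr)

/-- **Item 19282 from `PublishedInputsFive` (19066) instead of 19283** — the same composition with the published inputs
unpacked from the rank-one support item (the binder `h₅` of `closes`). CONDITIONAL on (2.4)∃♭ᴮ on the ¬(ram) pairs.
[cite: Castella2018Exceptional, Thms. 2.10–2.11 (arXiv:1507.04260 pp. 13–14)] [cite: Castella2018Erratum, (2.4) (p. 4)] -/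
theorem openInputNotRam_of_publishedInputsFive_of_pNew_of_imcDivSomeFrameB
    (hF : ErratumRoadFive.PublishedInputsFive) (hB : thm210_thm211_bdpDisplay_pNew)
    (hDiv : ∀ (W : WeierstrassCurve ℚ) [W.IsElliptic] [W.IsGloballyMinimal] (p : ℕ) [Fact p.Prime],
      ¬ Ram W p → P2.IMCDivSomeFrameOnTreeB W p) :
    ErratumRoadFive.OpenInputNotRam := by
  obtain ⟨-, hKo, -, -, -, hGZK, -, hnf, -, -, -, -, -, hPT, hEP⟩ := hF
  intro W _ _ p _ hnr
  exact openInputOnTreeAt_of_imcDivSomeFrameB_of_pNew hnf hGZK hKo hPT hEP hB (hDiv W p hnr)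

/-- **Item 19624 `RamNoErratumDataAtFive` (REST‴) from item 19283 + the JIMJ18 fact + (2.4)∃♭ᴮ on its pairs** (oriented
twin of g12's `ramNoErratumDataAtFive_of_publishedInputs_of_pNew_of_imcDivSomeFrame`). CONDITIONAL on (2.4)∃♭ᴮ there.
[cite: Castella2018Exceptional, Thms. 2.10–2.11 (arXiv:1507.04260 pp. 13–14)]
[cite: Castella2018Erratum, (2.4) and Thm. 1.1 (iii)–(iv) (pp. 1, 4)] [cite: Castella2018, Thms. 2.3, 3.1, 3.2, §5] -/
theorem ramNoErratumDataAtFive_of_publishedInputs_of_pNew_of_imcDivSomeFrameB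
    (hF : ErratumRoadFive.PublishedInputsIMCReduction) (hB : thm210_thm211_bdpDisplay_pNew)
    (hDiv : ∀ (W : WeierstrassCurve ℚ) [W.IsElliptic] [W.IsGloballyMinimal] (p : ℕ) [Fact p.Prime],
      Ram W p →
      ¬ ((∃ (q : ℕ) (_ : Fact q.Prime), q ≠ 2 ∧ q ≠ p ∧ Mult W q ∧
          ¬ W.HasSplitMultiplicativeReductionAtPrime q ∧ ¬ p ∣ padicValInt q W.minimalDiscriminantInt) ∧
        (∀ P : (W.baseChange ℚ_[p]).toAffine.Point, p • P = 0 → P = 0)) →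
      P2.IMCDivSomeFrameOnTreeB W p) :
    ErratumRoadFive.RamNoErratumDataAtFive := by
  obtain ⟨-, hGZK, -, hnf, -, -, -, -, hKo, -, -, hPT, -, -, hEP, -⟩ := hF
  intro W _ _ p _ hram hno
  exact openInputOnTreeAt_of_imcDivSomeFrameB_of_pNew hnf hGZK hKo hPT hEP hB (hDiv W p hram hno)

/-- **Item 19624 from `PublishedInputsFive` (19066).** CONDITIONAL on (2.4)∃♭ᴮ on the REST‴ pairs.
[cite: Castella2018Exceptional, Thms. 2.10–2.11 (arXiv:1507.04260 pp. 13–14)] [cite: Castella2018Erratum, (2.4) (p. 4)] -/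
theorem ramNoErratumDataAtFive_of_publishedInputsFive_of_pNew_of_imcDivSomeFrameB
    (hF : ErratumRoadFive.PublishedInputsFive) (hB : thm210_thm211_bdpDisplay_pNew)
    (hDiv : ∀ (W : WeierstrassCurve ℚ) [W.IsElliptic] [W.IsGloballyMinimal] (p : ℕ) [Fact p.Prime],
      Ram W p →
      ¬ ((∃ (q : ℕ) (_ : Fact q.Prime), q ≠ 2 ∧ q ≠ p ∧ Mult W q ∧
          ¬ W.HasSplitMultiplicativeReductionAtPrime q ∧ ¬ p ∣ padicValInt q W.minimalDiscriminantInt) ∧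
        (∀ P : (W.baseChange ℚ_[p]).toAffine.Point, p • P = 0 → P = 0)) →
      P2.IMCDivSomeFrameOnTreeB W p) :
    ErratumRoadFive.RamNoErratumDataAtFive := by
  obtain ⟨-, hKo, -, -, -, hGZK, -, hnf, -, -, -, -, -, hPT, hEP⟩ := hF
  intro W _ _ p _ hram hno
  exact openInputOnTreeAt_of_imcDivSomeFrameB_of_pNew hnf hGZK hKo hPT hEP hB (hDiv W p hram hno)

/-- **The aside parent 19061 `OpenInputIMC` ITSELF from item 19283 + the JIMJ18 fact + (2.4)∃♭ᴮ on ALL classical data**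
(oriented twin of g12's `openInputIMC_of_publishedInputs_of_pNew_of_imcDivSomeFrameAll`): read at classical Heegner
fields everywhere, K2's open input at `p ≥ 5` is ONE value-free, correctly ORIENTED conjecture-shaped statement.
CONDITIONAL on (2.4)∃♭ᴮ everywhere (OPEN); nothing booked.
[cite: Castella2018Exceptional, Thms. 2.10–2.11 (arXiv:1507.04260 pp. 13–14)]
[cite: Castella2018Erratum, (2.4) (p. 4)] [cite: Castella2018, Thms. 2.3, 3.1, 3.2, §5] -/
theorem openInputIMC_of_publishedInputs_of_pNew_of_imcDivSomeFrameBAll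
    (hF : ErratumRoadFive.PublishedInputsIMCReduction) (hB : thm210_thm211_bdpDisplay_pNew)
    (hDiv : ∀ (W : WeierstrassCurve ℚ) [W.IsElliptic] [W.IsGloballyMinimal] (p : ℕ) [Fact p.Prime],
      P2.IMCDivSomeFrameOnTreeB W p) :
    ErratumRoadFive.OpenInputIMC := by
  obtain ⟨-, hGZK, -, hnf, -, -, -, -, hKo, -, -, hPT, -, -, hEP, -⟩ := hF
  exact fun W _ _ p _ ↦ openInputOnTreeAt_of_imcDivSomeFrameB_of_pNew hnf hGZK hKo hPT hEP hB (hDiv W p)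

end Summit.BirchSwinnertonDyer.BirchSwinnertonDyer.Theorems

end
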